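import Summits.RiemannHypothesis.RiemannHypothesis.Theorems.OddSectorOddArchAnchorFold
import HarnessLib

/-!
# `OddOneSignedWindows` (stmt-RiemannHypothesis-17778), negative lemmas I: the antidiagonal test pair, pointwise

Part 1 of 3 of the standing disprover's negative lemma "the antisymmetric fold RAISES Weil's
energy at every window `a > (log 2)/2`" (main file `OddFoldRaisesEnergy.lean`, same directory;
see its module docstring for the statement, the mechanism and the bearing on the crux).

This part is measure-free bookkeeping: a smooth bump `p` (`0 ≤ p ≤ 1`, `p ≠ 0` only on
`(τ₀ − η, τ₀ + η)`, `0 < η < τ₀`, `τ₀ + η < log 2 − τ₀ − η`), its mirror `q = p(log 2 − ·)` at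
`σ₀ = log 2 − τ₀` (so `τ₀ + σ₀ = log 2`: the pair sits on the prime-2 REFLECTION antidiagonal),
the odd functions `r₁ = p − p(−·)`, `r₂ = q − q(−·)` and the pair `G = r₁ − r₂`, `H = r₁ + r₂`.

* §1–2: `sinh y ≤ 1` (`y ≤ 1/2`), `Λ(2)/√2 ≥ 2/5`; bump norms `∫ φ ≤ 2η`, `∫ φ² ≥ η`.
* §3 (`incr_mul_incr_eq`): for `t > 0` the product of increments
  `(r₁(x+t) − r₁(x))(r₂(x+t) − r₂(x))` has exactly four surviving terms — two reflection terms
  (`+`, alive at `t = log 2`) and two translation terms (`−`, alive only for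
  `t ∈ (log 2 − 2τ₀ − 2η, log 2 − 2τ₀ + 2η)`); the other twelve vanish by supports.
* §4: `|H| = |G|`, both odd, `H` real `≥ 0` on `(0,∞)`, the FOLD DOMINATION
  `|H s − H x| ≤ |G s − G x|` (`x, s > 0`), common support `[-(σ₀ + η), σ₀ + η]`.

Everything inline (no `def`), all `[folklore]`.
-/

noncomputable section

open Set MeasureTheory Filter Metric
open scoped Real Topology ComplexConjugate

namespace Summit.RiemannHypothesis.Cruxes.OddOneSignedWindows.Negative

open Literature.NumberTheory.LFunctions

/-! ## 1. Small real-analysis tools -/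

/-- `sinh y ≤ 1` for `y ≤ 1/2` (`sinh (1/2) < e^{1/2}/2 < 1`). [folklore] -/
theorem sinh_le_one {y : ℝ} (hy : y ≤ 1 / 2) : Real.sinh y ≤ 1 := by
  have h1 : Real.sinh y ≤ Real.sinh (1 / 2) := Real.sinh_le_sinh.2 hy
  have h2 : Real.sinh (1 / 2) < Real.exp (1 / 2) / 2 := by
    rw [Real.sinh_eq]
    have := Real.exp_pos (-(1 / 2 : ℝ))
    linarith
  have h3 : Real.exp (1 / 2) < 2 := by
    have hmul : Real.exp (1 / 2) * Real.exp (1 / 2) = Real.exp 1 := by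
      rw [← Real.exp_add]
      norm_num
    have he := Real.exp_one_lt_d9
    nlinarith [Real.exp_pos (1 / 2 : ℝ)]
  linarith

/-- `Λ(2)/√2 ≥ 2/5` (`log 2 > 0.693`, `√2 < 3/2`). [folklore] -/
theorem two_fifths_le_vonMangoldt_two_div :
    (2 / 5 : ℝ) ≤ (ArithmeticFunction.vonMangoldt 2 : ℝ) / Real.sqrt 2 := by
  rw [ArithmeticFunction.vonMangoldt_apply_prime Nat.prime_two]
  push_cast
  have hlog := Real.log_two_gt_d9
  have hsqrt : Real.sqrt 2 < 3 / 2 := by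
    rw [Real.sqrt_lt' (by norm_num)]
    norm_num
  have hsqrt0 : 0 < Real.sqrt 2 := Real.sqrt_pos.2 two_pos
  rw [le_div_iff₀ hsqrt0]
  nlinarith

/-! ## 2. Bump bookkeeping

A bump `φ : ContDiffBump τ₀` with `rIn = η/2`, `rOut = η`: smooth, `0 ≤ φ ≤ 1`, `φ = 1` on
`[τ₀ − η/2, τ₀ + η/2]`, `φ = 0` off `(τ₀ − η, τ₀ + η)`; hence `∫ φ ≤ 2η` and `∫ φ² ≥ η`. -/

section Bump

variable {τ₀ η : ℝ} (φ : ContDiffBump τ₀)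

/-- Off the open ball the bump vanishes. [folklore] -/
theorem bump_support {y : ℝ} (hφ : φ.rOut = η) (h : φ y ≠ 0) : τ₀ - η < y ∧ y < τ₀ + η := by
  have hy : y ∈ Function.support (φ : ℝ → ℝ) := h
  rw [φ.support_eq, hφ, Metric.mem_ball, Real.dist_eq, abs_lt] at hy
  constructor <;> linarith [hy.1, hy.2]

/-- On the inner ball the bump is `1`. [folklore] -/
theorem bump_eq_one {y : ℝ} (hφ : φ.rIn = η / 2) (hy : |y - τ₀| ≤ η / 2) : φ y = 1 :=
  φ.one_of_mem_closedBall (by rwa [Metric.mem_closedBall, Real.dist_eq, hφ])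

/-- The bump is integrable. [folklore] -/
theorem integrable_bump : Integrable (φ : ℝ → ℝ) :=
  φ.continuous.integrable_of_hasCompactSupport φ.hasCompactSupport

/-- The square of the bump is integrable. [folklore] -/
theorem integrable_bump_sq : Integrable fun y ↦ φ y * φ y :=
  (φ.continuous.mul φ.continuous).integrable_of_hasCompactSupport φ.hasCompactSupport.mul_right

/-- `∫ φ ≤ 2η`. [folklore] -/
theorem integral_bump_le (hφ : φ.rOut = η) (hη : 0 < η) : ∫ y, φ y ≤ 2 * η := by
  have hle : ∀ y, φ y ≤ (Icc (τ₀ - η) (τ₀ + η)).indicator (fun _ ↦ (1 : ℝ)) y := by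
    intro y
    by_cases hy : y ∈ Icc (τ₀ - η) (τ₀ + η)
    · rw [indicator_of_mem hy]
      exact φ.le_one
    · rw [indicator_of_notMem hy]
      by_contra hne
      have hb := bump_support φ hφ (fun h0 ↦ hne (by rw [h0]))
      exact hy ⟨hb.1.le, hb.2.le⟩
  have hint : Integrable ((Icc (τ₀ - η) (τ₀ + η)).indicator fun _ ↦ (1 : ℝ)) :=
    (integrableOn_const (by simp)).integrable_indicator measurableSet_Icc
  calc ∫ y, φ y ≤ ∫ y, (Icc (τ₀ - η) (τ₀ + η)).indicator (fun _ ↦ (1 : ℝ)) y :=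
        integral_mono (integrable_bump φ) hint hle
    _ = 2 * η := by
        rw [integral_indicator_const _ measurableSet_Icc, Real.volume_real_Icc_of_le (by linarith),
          smul_eq_mul, mul_one]
        ring

/-- `η ≤ ∫ φ²`. [folklore] -/
theorem le_integral_bump_sq (hφ : φ.rIn = η / 2) (hη : 0 < η) : η ≤ ∫ y, φ y * φ y := by
  have hle : ∀ y, (Icc (τ₀ - η / 2) (τ₀ + η / 2)).indicator (fun _ ↦ (1 : ℝ)) y ≤ φ y * φ y := by
    intro y
    by_cases hy : y ∈ Icc (τ₀ - η / 2) (τ₀ + η / 2)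
    · rw [indicator_of_mem hy, bump_eq_one φ hφ (abs_le.2 ⟨by linarith [hy.1], by linarith [hy.2]⟩)]
      norm_num
    · rw [indicator_of_notMem hy]
      exact mul_nonneg φ.nonneg φ.nonneg
  have hint : Integrable ((Icc (τ₀ - η / 2) (τ₀ + η / 2)).indicator fun _ ↦ (1 : ℝ)) :=
    (integrableOn_const (by simp)).integrable_indicator measurableSet_Icc
  calc η = ∫ y, (Icc (τ₀ - η / 2) (τ₀ + η / 2)).indicator (fun _ ↦ (1 : ℝ)) y := by
        rw [integral_indicator_const _ measurableSet_Icc, Real.volume_real_Icc_of_le (by linarith),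
          smul_eq_mul, mul_one]
        ring
    _ ≤ ∫ y, φ y * φ y := integral_mono hint (integrable_bump_sq φ) hle

end Bump

/-! ## 3. The test pair on the prime-2 antidiagonal: pointwise structure

Data: a smooth `p : ℝ → ℝ` with `0 ≤ p ≤ 1`, `p ≠ 0` only on `(τ₀ − η, τ₀ + η)`, where
`0 < η < τ₀` and `τ₀ + η < log 2 − τ₀ − η` (so with `σ₀ := log 2 − τ₀` the mirror bump
`q := p (log 2 − ·)` lives on `(σ₀ − η, σ₀ + η)`, to the right of `p`, both inside `(0, log 2)`).
The odd functions are `r₁ = p − p(−·)`, `r₂ = q − q(−·)`, and the pair is `G = r₁ − r₂`,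
`H = r₁ + r₂` (as complex-valued functions). -/

section Pair

variable {p : ℝ → ℝ} {τ₀ η : ℝ}

/-- **The key pointwise identity.** For `t > 0` the product of the increments of `r₁` and `r₂`
has exactly four surviving terms: two REFLECTION terms (`+`) and two TRANSLATION terms (`−`);
the other twelve products vanish by support considerations. [folklore] -/
theorem incr_mul_incr_eq (hη : 0 < η) (hτ : η < τ₀) (hsep : τ₀ + η < Real.log 2 - τ₀ - η)
    (hps : ∀ y, p y ≠ 0 → τ₀ - η < y ∧ y < τ₀ + η) {t : ℝ} (ht : 0 < t) (x : ℝ) :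
    (p (x + t) - p (-(x + t)) - (p x - p (-x))) *
        (p (Real.log 2 - (x + t)) - p (Real.log 2 - -(x + t)) -
          (p (Real.log 2 - x) - p (Real.log 2 - -x))) =
      p (x + t) * p (Real.log 2 - -x) + p (-x) * p (Real.log 2 - (x + t)) -
        p (-(x + t)) * p (Real.log 2 - -x) - p x * p (Real.log 2 - (x + t)) := by
  -- the twelve vanishing products
  have v : ∀ u v : ℝ, (p u ≠ 0 → p v ≠ 0 → False) → p u * p v = 0 := fun u v h ↦ by
    by_contra hne
    exact h (left_ne_zero_of_mul hne) (right_ne_zero_of_mul hne)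
  have hAA : p (x + t) * p (Real.log 2 - (x + t)) = 0 :=
    v _ _ fun h1 h2 ↦ by have b1 := hps _ h1; have b2 := hps _ h2; linarith [b1.2, b2.2]
  have hAB : p (x + t) * p (Real.log 2 - -(x + t)) = 0 :=
    v _ _ fun h1 h2 ↦ by have b1 := hps _ h1; have b2 := hps _ h2; linarith [b1.1, b2.2]
  have hAC : p (x + t) * p (Real.log 2 - x) = 0 :=
    v _ _ fun h1 h2 ↦ by have b1 := hps _ h1; have b2 := hps _ h2; linarith [b1.2, b2.2]
  have hBA : p (-(x + t)) * p (Real.log 2 - (x + t)) = 0 :=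
    v _ _ fun h1 h2 ↦ by have b1 := hps _ h1; have b2 := hps _ h2; linarith [b1.1, b2.2]
  have hBB : p (-(x + t)) * p (Real.log 2 - -(x + t)) = 0 :=
    v _ _ fun h1 h2 ↦ by have b1 := hps _ h1; have b2 := hps _ h2; linarith [b1.2, b2.2]
  have hBC : p (-(x + t)) * p (Real.log 2 - x) = 0 :=
    v _ _ fun h1 h2 ↦ by have b1 := hps _ h1; have b2 := hps _ h2; linarith [b1.1, b2.2]
  have hCB : p x * p (Real.log 2 - -(x + t)) = 0 :=
    v _ _ fun h1 h2 ↦ by have b1 := hps _ h1; have b2 := hps _ h2; linarith [b1.1, b2.2]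
  have hCC : p x * p (Real.log 2 - x) = 0 :=
    v _ _ fun h1 h2 ↦ by have b1 := hps _ h1; have b2 := hps _ h2; linarith [b1.2, b2.2]
  have hCD : p x * p (Real.log 2 - -x) = 0 :=
    v _ _ fun h1 h2 ↦ by have b1 := hps _ h1; have b2 := hps _ h2; linarith [b1.1, b2.2]
  have hDB : p (-x) * p (Real.log 2 - -(x + t)) = 0 :=
    v _ _ fun h1 h2 ↦ by have b1 := hps _ h1; have b2 := hps _ h2; linarith [b1.2, b2.2, b1.1, b2.1]
  have hDC : p (-x) * p (Real.log 2 - x) = 0 :=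
    v _ _ fun h1 h2 ↦ by have b1 := hps _ h1; have b2 := hps _ h2; linarith [b1.1, b2.2]
  have hDD : p (-x) * p (Real.log 2 - -x) = 0 :=
    v _ _ fun h1 h2 ↦ by have b1 := hps _ h1; have b2 := hps _ h2; linarith [b1.2, b2.2]
  linear_combination hAA - hAB - hAC - hBA + hBB + hBC + hCB + hCC - hCD - hDB - hDC + hDD

/-- Off the translation window `I = (log 2 − 2τ₀ − 2η, log 2 − 2τ₀ + 2η)` the two translation
terms vanish as well, so the product of increments is `≥ 0`. [folklore] -/
theorem incr_mul_incr_nonneg_of_notMem (hη : 0 < η) (hτ : η < τ₀)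
    (hsep : τ₀ + η < Real.log 2 - τ₀ - η) (hp0 : ∀ y, 0 ≤ p y)
    (hps : ∀ y, p y ≠ 0 → τ₀ - η < y ∧ y < τ₀ + η) {t : ℝ} (ht : 0 < t)
    (htI : t ∉ Ioo (Real.log 2 - 2 * τ₀ - 2 * η) (Real.log 2 - 2 * τ₀ + 2 * η)) (x : ℝ) :
    0 ≤ (p (x + t) - p (-(x + t)) - (p x - p (-x))) *
        (p (Real.log 2 - (x + t)) - p (Real.log 2 - -(x + t)) -
          (p (Real.log 2 - x) - p (Real.log 2 - -x))) := by
  rw [incr_mul_incr_eq hη hτ hsep hps ht x]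
  have v : ∀ u v : ℝ, (p u ≠ 0 → p v ≠ 0 → False) → p u * p v = 0 := fun u v h ↦ by
    by_contra hne
    exact h (left_ne_zero_of_mul hne) (right_ne_zero_of_mul hne)
  rw [mem_Ioo, not_and_or, not_lt, not_lt] at htI
  have hBD : p (-(x + t)) * p (Real.log 2 - -x) = 0 :=
    v _ _ fun h1 h2 ↦ by
      have b1 := hps _ h1; have b2 := hps _ h2
      rcases htI with h | h <;> linarith [b1.1, b1.2, b2.1, b2.2]
  have hCA : p x * p (Real.log 2 - (x + t)) = 0 :=
    v _ _ fun h1 h2 ↦ by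
      have b1 := hps _ h1; have b2 := hps _ h2
      rcases htI with h | h <;> linarith [b1.1, b1.2, b2.1, b2.2]
  rw [hBD, hCA, sub_zero, sub_zero]
  exact add_nonneg (mul_nonneg (hp0 _) (hp0 _)) (mul_nonneg (hp0 _) (hp0 _))

/-- For every `t > 0` the product of increments is `≥ −p(−(x+t)) − p(x)` (`0 ≤ p ≤ 1`). [folklore] -/
theorem neg_le_incr_mul_incr (hη : 0 < η) (hτ : η < τ₀)
    (hsep : τ₀ + η < Real.log 2 - τ₀ - η) (hp0 : ∀ y, 0 ≤ p y) (hp1 : ∀ y, p y ≤ 1)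
    (hps : ∀ y, p y ≠ 0 → τ₀ - η < y ∧ y < τ₀ + η) {t : ℝ} (ht : 0 < t) (x : ℝ) :
    -(p (-(x + t)) + p x) ≤ (p (x + t) - p (-(x + t)) - (p x - p (-x))) *
        (p (Real.log 2 - (x + t)) - p (Real.log 2 - -(x + t)) -
          (p (Real.log 2 - x) - p (Real.log 2 - -x))) := by
  rw [incr_mul_incr_eq hη hτ hsep hps ht x]
  have h1 : 0 ≤ p (x + t) * p (Real.log 2 - -x) := mul_nonneg (hp0 _) (hp0 _)
  have h2 : 0 ≤ p (-x) * p (Real.log 2 - (x + t)) := mul_nonneg (hp0 _) (hp0 _)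
  have h3 : p (-(x + t)) * p (Real.log 2 - -x) ≤ p (-(x + t)) :=
    (mul_le_mul_of_nonneg_left (hp1 _) (hp0 _)).trans_eq (mul_one _)
  have h4 : p x * p (Real.log 2 - (x + t)) ≤ p x :=
    (mul_le_mul_of_nonneg_left (hp1 _) (hp0 _)).trans_eq (mul_one _)
  linarith

/-- At the reflection length `t = log 2` only the two reflection terms survive and they are the
squares `p(x + log 2)²`, `p(−x)²`. [folklore] -/
theorem incr_mul_incr_log_two (hη : 0 < η) (hτ : η < τ₀)
    (hsep : τ₀ + η < Real.log 2 - τ₀ - η)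
    (hps : ∀ y, p y ≠ 0 → τ₀ - η < y ∧ y < τ₀ + η) (x : ℝ) :
    (p (x + Real.log 2) - p (-(x + Real.log 2)) - (p x - p (-x))) *
        (p (Real.log 2 - (x + Real.log 2)) - p (Real.log 2 - -(x + Real.log 2)) -
          (p (Real.log 2 - x) - p (Real.log 2 - -x))) =
      p (x + Real.log 2) * p (x + Real.log 2) + p (-x) * p (-x) := by
  have hlog : 0 < Real.log 2 := by linarith
  rw [incr_mul_incr_eq hη hτ hsep hps hlog x]
  have v : ∀ u v : ℝ, (p u ≠ 0 → p v ≠ 0 → False) → p u * p v = 0 := fun u v h ↦ by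
    by_contra hne
    exact h (left_ne_zero_of_mul hne) (right_ne_zero_of_mul hne)
  have hBD : p (-(x + Real.log 2)) * p (Real.log 2 - -x) = 0 :=
    v _ _ fun h1 h2 ↦ by have b1 := hps _ h1; have b2 := hps _ h2; linarith [b1.1, b1.2, b2.1, b2.2]
  have hCA : p x * p (Real.log 2 - (x + Real.log 2)) = 0 :=
    v _ _ fun h1 h2 ↦ by have b1 := hps _ h1; have b2 := hps _ h2; linarith [b1.1, b1.2, b2.1, b2.2]
  have e1 : p (Real.log 2 - -x) = p (x + Real.log 2) := by congr 1; ring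
  have e2 : p (Real.log 2 - (x + Real.log 2)) = p (-x) := by congr 1; ring
  rw [hBD, hCA, e1, e2]
  ring

end Pair

/-! ## 4. The pair `G = r₁ − r₂`, `H = r₁ + r₂`: pointwise facts -/

section PairPointwise

variable {p r₁ r₂ : ℝ → ℝ} {G H : ℝ → ℂ} {τ₀ η : ℝ}
  (hη : 0 < η) (hτ : η < τ₀) (hsep : τ₀ + η < Real.log 2 - τ₀ - η)
  (hp0 : ∀ y, 0 ≤ p y) (hps : ∀ y, p y ≠ 0 → τ₀ - η < y ∧ y < τ₀ + η)
  (hr₁ : ∀ y, r₁ y = p y - p (-y)) (hr₂ : ∀ y, r₂ y = p (Real.log 2 - y) - p (Real.log 2 - -y))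
  (hGr : ∀ x, G x = ((r₁ x - r₂ x : ℝ) : ℂ)) (hHr : ∀ x, H x = ((r₁ x + r₂ x : ℝ) : ℂ))

include hη hτ hsep hps hr₁ hr₂ in
/-- `r₁ r₂ = 0` pointwise (the four bumps `p`, `p(−·)`, `q`, `q(−·)` have disjoint supports). [folklore] -/
theorem r₁_mul_r₂ (x : ℝ) : r₁ x * r₂ x = 0 := by
  have v : ∀ u v : ℝ, (p u ≠ 0 → p v ≠ 0 → False) → p u * p v = 0 := fun u v h ↦ by
    by_contra hne
    exact h (left_ne_zero_of_mul hne) (right_ne_zero_of_mul hne)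
  have hCC : p x * p (Real.log 2 - x) = 0 :=
    v _ _ fun h1 h2 ↦ by have b1 := hps _ h1; have b2 := hps _ h2; linarith [b1.2, b2.2]
  have hCD : p x * p (Real.log 2 - -x) = 0 :=
    v _ _ fun h1 h2 ↦ by have b1 := hps _ h1; have b2 := hps _ h2; linarith [b1.1, b2.2]
  have hDC : p (-x) * p (Real.log 2 - x) = 0 :=
    v _ _ fun h1 h2 ↦ by have b1 := hps _ h1; have b2 := hps _ h2; linarith [b1.1, b2.2]
  have hDD : p (-x) * p (Real.log 2 - -x) = 0 :=
    v _ _ fun h1 h2 ↦ by have b1 := hps _ h1; have b2 := hps _ h2; linarith [b1.2, b2.2]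
  rw [hr₁, hr₂]
  linear_combination hCC - hCD - hDC + hDD

include hη hτ hsep hps hr₁ hr₂ hGr hHr in
/-- `|H| = |G|` pointwise. [folklore] -/
theorem norm_H_eq (x : ℝ) : ‖H x‖ = ‖G x‖ := by
  rw [hHr, hGr, Complex.norm_real, Complex.norm_real, Real.norm_eq_abs, Real.norm_eq_abs, abs_eq_abs]
  rcases mul_eq_zero.1 (r₁_mul_r₂ hη hτ hsep hps hr₁ hr₂ x) with h | h
  · exact Or.inr (by rw [h]; ring)
  · exact Or.inl (by rw [h]; ring)

include hr₁ hr₂ hGr in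
/-- `G` is odd. [folklore] -/
theorem G_odd (x : ℝ) : G (-x) = -G x := by
  rw [hGr, hGr, hr₁, hr₁, hr₂, hr₂, neg_neg]; push_cast; ring

include hr₁ hr₂ hHr in
/-- `H` is odd. [folklore] -/
theorem H_odd (x : ℝ) : H (-x) = -H x := by
  rw [hHr, hHr, hr₁, hr₁, hr₂, hr₂, neg_neg]; push_cast; ring

include hη hτ hsep hp0 hps hr₁ hr₂ hHr in
/-- On the right half-line `H = p + q ≥ 0` is real and non-negative. [folklore] -/
theorem H_sign {x : ℝ} (hx : 0 < x) : (H x).im = 0 ∧ 0 ≤ (H x).re := by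
  have h1 : p (-x) = 0 := by
    by_contra h
    have b := hps _ h
    linarith [b.1]
  have h2 : p (Real.log 2 - -x) = 0 := by
    by_contra h
    have b := hps _ h
    linarith [b.2]
  rw [hHr, hr₁, hr₂, h1, h2, Complex.ofReal_im, Complex.ofReal_re]
  exact ⟨rfl, by linarith [hp0 x, hp0 (Real.log 2 - x)]⟩

include hη hτ hsep hp0 hps hr₁ hr₂ hGr hHr in
/-- **Fold domination**: `|H s − H x| ≤ |G s − G x|` for `x, s > 0` (on the half-line
`H = p + q`, `G = p − q`, and `(p s − p x)(q s − q x) ≤ 0` by disjointness of supports). [folklore] -/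
theorem norm_H_sub_le {x s : ℝ} (hx : 0 < x) (hs : 0 < s) : ‖H s - H x‖ ≤ ‖G s - G x‖ := by
  have hz : ∀ y, 0 < y → p (-y) = 0 ∧ p (Real.log 2 - -y) = 0 := fun y hy ↦ by
    constructor
    · by_contra h
      have b := hps _ h
      linarith [b.1]
    · by_contra h
      have b := hps _ h
      linarith [b.2]
  have v : ∀ u v : ℝ, (p u ≠ 0 → p v ≠ 0 → False) → p u * p v = 0 := fun u v h ↦ by
    by_contra hne
    exact h (left_ne_zero_of_mul hne) (right_ne_zero_of_mul hne)
  have hss : p s * p (Real.log 2 - s) = 0 :=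
    v _ _ fun h1 h2 ↦ by have b1 := hps _ h1; have b2 := hps _ h2; linarith [b1.2, b2.2]
  have hxx : p x * p (Real.log 2 - x) = 0 :=
    v _ _ fun h1 h2 ↦ by have b1 := hps _ h1; have b2 := hps _ h2; linarith [b1.2, b2.2]
  have huv : (p s - p x) * (p (Real.log 2 - s) - p (Real.log 2 - x)) ≤ 0 := by
    have h1 : 0 ≤ p s * p (Real.log 2 - x) := mul_nonneg (hp0 _) (hp0 _)
    have h2 : 0 ≤ p x * p (Real.log 2 - s) := mul_nonneg (hp0 _) (hp0 _)
    nlinarith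
  rw [hHr, hHr, hGr, hGr, hr₁, hr₁, hr₂, hr₂, (hz s hs).1, (hz s hs).2, (hz x hx).1, (hz x hx).2,
    ← Complex.ofReal_sub, ← Complex.ofReal_sub, Complex.norm_real, Complex.norm_real,
    Real.norm_eq_abs, Real.norm_eq_abs]
  refine sq_le_sq.1 ?_
  nlinarith

include hη hτ hsep hps hr₁ hr₂ hGr hHr in
/-- Outside `[-(log 2 − τ₀ + η), log 2 − τ₀ + η]` both `G` and `H` vanish. [folklore] -/
theorem GH_eq_zero {x : ℝ} (hx : x < -(Real.log 2 - τ₀ + η) ∨ Real.log 2 - τ₀ + η < x) :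
    G x = 0 ∧ H x = 0 := by
  have pz : ∀ y, (y ≤ τ₀ - η ∨ τ₀ + η ≤ y) → p y = 0 := fun y hy ↦ by
    by_contra h
    have b := hps y h
    rcases hy with hy | hy <;> linarith
  have h1 : p x = 0 := pz _ (by rcases hx with hx | hx <;> [left; right] <;> linarith)
  have h2 : p (-x) = 0 := pz _ (by rcases hx with hx | hx <;> [right; left] <;> linarith)
  have h3 : p (Real.log 2 - x) = 0 := pz _ (by rcases hx with hx | hx <;> [right; left] <;> linarith)
  have h4 : p (Real.log 2 - -x) = 0 :=
    pz _ (by rcases hx with hx | hx <;> [left; right] <;> linarith)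
  rw [hGr, hHr, hr₁, hr₂, h1, h2, h3, h4]
  simp

include hη hτ hsep hps hr₁ hr₂ hGr hHr in
/-- `tsupport G, tsupport H ⊆ [-(log 2 − τ₀ + η), log 2 − τ₀ + η]`. [folklore] -/
theorem tsupport_GH_subset :
    tsupport G ⊆ Icc (-(Real.log 2 - τ₀ + η)) (Real.log 2 - τ₀ + η) ∧
      tsupport H ⊆ Icc (-(Real.log 2 - τ₀ + η)) (Real.log 2 - τ₀ + η) := by
  constructor
  · refine closure_minimal (fun x hx ↦ ?_) isClosed_Icc
    by_contra hn
    rw [mem_Icc, not_and_or, not_le, not_le] at hn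
    exact hx (GH_eq_zero hη hτ hsep hps hr₁ hr₂ hGr hHr hn).1
  · refine closure_minimal (fun x hx ↦ ?_) isClosed_Icc
    by_contra hn
    rw [mem_Icc, not_and_or, not_le, not_le] at hn
    exact hx (GH_eq_zero hη hτ hsep hps hr₁ hr₂ hGr hHr hn).2

include hη hτ hsep hps hr₁ hr₂ hGr hHr in
/-- `G` and `H` have compact support. [folklore] -/
theorem hasCompactSupport_GH : HasCompactSupport G ∧ HasCompactSupport H :=
  ⟨HasCompactSupport.intro isCompact_Icc fun x hx ↦
      (GH_eq_zero hη hτ hsep hps hr₁ hr₂ hGr hHr (x := x)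
        (by rwa [mem_Icc, not_and_or, not_le, not_le] at hx)).1,
    HasCompactSupport.intro isCompact_Icc fun x hx ↦
      (GH_eq_zero hη hτ hsep hps hr₁ hr₂ hGr hHr (x := x)
        (by rwa [mem_Icc, not_and_or, not_le, not_le] at hx)).2⟩

end PairPointwise

end Summit.RiemannHypothesis.Cruxes.OddOneSignedWindows.Negative

end
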